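import Summits.CriticalPhenomena.SAWScalingLimit.Theorems.SAWTwistedSelfEnergySubseqIdentificationParaExplorationData
import Summits.CriticalPhenomena.SAWScalingLimit.Theorems.SAWTwistedSelfEnergySubseqIdentificationParaPassageAssemblyFunctional
import Summits.CriticalPhenomena.SAWScalingLimit.Theorems.SAWTwistedSelfEnergySubseqIdentificationParaPassageAssemblyData
import Summits.CriticalPhenomena.SAWScalingLimit.Theorems.SAWRenewalTightnessRoomPassageEvents
import HarnessLib

/-!
# One level of the diagonal para passage: exploration data off the four bad events, and the frozen
# extension of the cylinder identity from a fixed starting time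
(crux `SubseqIdentification`, stmt-CriticalPhenomena-0783; line `parafermionic-martingale`, helpers of the
split piece S3c `stub_paraPassageAssembly` of the XL passage stub `stub_paraPassage`; stub-worker of the
lead c6)

* `exists_levelData` — ONE MESH of the diagonal passage (the para twin of `exists_explorationDataPos`
  of the room line): from the landed per-scale exploration data `stub_paraExplorationData` (S3b: the
  exploration filtration, first passages `σ ≤ τ ≤ M` of the levels `s₁ ≤ t₁`, the Doob parafermionic
  observable `Q` FROZEN into an exact complex martingale `G`, and the dichotomy
  `(G_σ = Q_j ∧ G_τ = Q_k) ∨ Q_k = 0` off the strong capacity event), the uniform bound of S2 (1) at this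
  mesh (`‖Q_k‖ ≤ C` at capped pasts, so `‖G‖ ≤ C`), the slit-uniform approximation of S2 (2) at this
  mesh off the no-return event (`‖Q_k - N(K_k, ξ_k, w)‖ ≤ εO`), the para fidelity of the drivers
  (`‖paraObsCap (V γ) w t_k - N(K_k, ξ_k, w)‖ ≤ ρF` at pasts of capacity `≥ S₀`) and the far-driver lower
  bound `exp_le_norm_paraObs_of_abs_le` (a vanishing observable at the first passage `k` would force
  `|V γ (t_k)| > Ξ`): off the union of the strong capacity event, the para fidelity event, the no-return
  event and the far-driver event `{∃ u ≤ T_w, |V γ u| ≥ Ξ}`, the stopped values `G_σ`, `G_τ` are within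
  `εO + ρF` of the capped observable of the driver `V γ` at the capacity times of the first passages.
* `integral_sub_mul_eq_zero_of_frozen_of_forall_le_lt` — the frozen extension of a complex cylinder
  identity from a FIXED starting time `s` (variant of the landed
  `integral_sub_mul_eq_zero_of_forall_lt_of_frozen_complex` whose hypothesis only asks for the identity
  at pairs `s ≤ s₁`, `0 < s₁ < t' < T` — the shape delivered by the passage with test times `S_k ≤ s`).

References: D. Chelkak, H. Duminil-Copin, C. Hongler, A. Kemppainen, S. Smirnov, C. R. Math. 352
(2014), §3; H. Duminil-Copin, S. Smirnov, Clay Math. Proc. 15 (2012), Lemma 6.6, Prop. 6.7.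
-/

noncomputable section

open MeasureTheory Filter Topology Set
open scoped NNReal ENNReal Classical BigOperators
open Literature.Probability.LatticeModels
open Literature.Probability.RandomPlanarGeometry
open UpperHalfPlane (upperHalfPlaneSet)

namespace Summit.CriticalPhenomena.SAWScalingLimit.Theorems.SubseqIdentification.ParaMartingale

open Summit.CriticalPhenomena.SAWScalingLimit.Theorems.SubseqIdentification.RoomEntropy
  (prefixAt capTimeOf noReturnEvent)

/-! ## One mesh of the diagonal passage -/

/-- `‖a - c‖ ≤ ‖a - b‖ + ‖c - b‖`. [folklore] -/
theorem norm_sub_le_norm_sub_add_norm_sub' (a b c : ℂ) : ‖a - c‖ ≤ ‖a - b‖ + ‖c - b‖ := by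
  rw [← norm_neg (c - b), neg_sub]; exact norm_sub_le_norm_sub_add_norm_sub a b c

/-- **One mesh of the diagonal para passage** (para twin of `exists_explorationDataPos`): see the
module docstring. The four bad events are written inline, in the shape of the registered driver stub
`stub_paraLatticeDrivers` (strong capacity event, para fidelity event), of `noReturnEvent`, and of the
far-driver level `exists_farLevel`. [cite: CDHKSCRAS2014, §3] -/
theorem exists_levelData {D : DobrushinDomain} (φ : ConformalEquiv upperHalfPlaneSet D.carrier)
    {δ : ℝ} {a a' b z : Site 2}
    [Finite (SAW.DomainSAW D.carrier δ a b)] [IsProbabilityMeasure (SAW.law D.carrier δ a b)]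
    (V : SAW.DomainSAW D.carrier δ a b → C(ℝ≥0, ℝ)) {w : ℂ} (hw : 0 < w.im)
    {S₀ s₁ t₁ : ℝ≥0} {θ ρF εO C R r Ξ ρ : ℝ}
    (hθ : 0 ≤ θ) (hS₀ : 0 < S₀) (hS : S₀ ≤ s₁) (hst : s₁ ≤ t₁)
    (hT : (t₁ : ℝ) + 2 * θ ≤ w.im ^ 2 / 16)
    (hcyl : ∀ (n : ℕ) (l : List (Site 2)), z ∉ l → l.length = n + 1 →
      (∀ v u : Site 2, l.getLast? = some v → (discreteDomainGraph D.carrier δ).Adj v u → u ∉ l →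
        (∃ ω : SAW.DomainSAW D.carrier δ u z, ∀ y ∈ ω.walk.support, y ∉ l) →
        ∃ ω : SAW.DomainSAW D.carrier δ u b, ∀ y ∈ ω.walk.support, y ∉ l) →
      ∫ γ in {γ : SAW.DomainSAW D.carrier δ a b | γ.walk.support.take (n + 1) = l},
          paraDoob D δ a a' b z γ (n + 1) ∂(SAW.law D.carrier δ a b) =
        ∫ γ in {γ : SAW.DomainSAW D.carrier δ a b | γ.walk.support.take (n + 1) = l},
          paraDoob D δ a a' b z γ n ∂(SAW.law D.carrier δ a b))
    (hstem : ∀ γ : SAW.DomainSAW D.carrier δ a b, LatticeSlit.capTime φ (prefixAt γ 0) ≤ θ)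
    (hcons : ∀ (γ γ' : SAW.DomainSAW D.carrier δ a b) (k : ℕ),
      (prefixAt γ k).support = (prefixAt γ' k).support →
      (S₀ : ℝ) ≤ LatticeSlit.capTime φ (prefixAt γ k) →
      ∀ u : ℝ≥0, (u : ℝ) ≤ LatticeSlit.capTime φ (prefixAt γ k) → V γ u = V γ' u)
    (hbound : ∀ (γ : SAW.DomainSAW D.carrier δ a b) (k : ℕ),
      LatticeSlit.capTime φ (prefixAt γ k) ≤ w.im ^ 2 / 16 → ‖paraDoob D δ a a' b z γ k‖ ≤ C)
    (happx : ∀ γ : SAW.DomainSAW D.carrier δ a b, γ ∉ noReturnEvent D δ a b R r →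
      ∀ k : ℕ, LatticeSlit.capTime φ (prefixAt γ k) ≤ w.im ^ 2 / 16 →
        ‖paraDoob D δ a a' b z γ k - hullParaObs (LatticeSlit.pastHull φ (prefixAt γ k))
          (LatticeSlit.drivingValue φ (prefixAt γ k)) w‖ ≤ εO)
    (hfar : εO + ρF < Real.exp (5 / 8 * (2 * Real.log ‖w‖ - 1 / 2 - 2 * Real.log (2 * ‖w‖ + Ξ))))
    (hθρ : θ ≤ ρ) (hερ : εO + ρF ≤ ρ) :
    ∃ (𝒢 : Filtration ℕ (inferInstance : MeasurableSpace (SAW.DomainSAW D.carrier δ a b)))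
      (G : ℕ → SAW.DomainSAW D.carrier δ a b → ℂ) (σ τ : SAW.DomainSAW D.carrier δ a b → WithTop ℕ)
      (hσ : IsStoppingTime 𝒢 σ) (M : ℕ),
      IsStoppingTime 𝒢 τ ∧ Martingale G 𝒢 (SAW.law D.carrier δ a b) ∧ σ ≤ τ ∧ (∀ γ, τ γ ≤ M) ∧
      (∀ u, u ≤ s₁ → Measurable[hσ.measurableSpace] fun γ => V γ u) ∧
      (∀ (m : ℕ) (γ : SAW.DomainSAW D.carrier δ a b), ‖G m γ‖ ≤ C) ∧
      ∀ γ : SAW.DomainSAW D.carrier δ a b,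
        γ ∉ {γ : SAW.DomainSAW D.carrier δ a b |
              (∀ k : ℕ, LatticeSlit.capTime φ (prefixAt γ k) ≤ w.im ^ 2 / 16) ∨
              ∃ (k : ℕ) (u : Site 2), LatticeSlit.capTime φ (prefixAt γ k) ≤ w.im ^ 2 / 16 ∧
                θ < LatticeSlit.capIncrement φ (prefixAt γ k) u} ∪
            {γ | ∃ k : ℕ, (S₀ : ℝ) ≤ LatticeSlit.capTime φ (prefixAt γ k) ∧
              LatticeSlit.capTime φ (prefixAt γ k) ≤ w.im ^ 2 / 16 ∧
              ρF < ‖paraObsCap (V γ) w (LatticeSlit.capTime φ (prefixAt γ k)).toNNReal -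
                hullParaObs (LatticeSlit.pastHull φ (prefixAt γ k))
                  (LatticeSlit.drivingValue φ (prefixAt γ k)) w‖} ∪
            noReturnEvent D δ a b R r ∪
            {γ | ∃ u ∈ Icc (0 : ℝ≥0) (capTimeOf w), Ξ ≤ |V γ u|} →
        (∃ u : ℝ≥0, s₁ ≤ u ∧ (u : ℝ) ≤ s₁ + ρ ∧ ‖stoppedValue G σ γ - paraObsCap (V γ) w u‖ ≤ ρ) ∧
        (∃ u : ℝ≥0, t₁ ≤ u ∧ (u : ℝ) ≤ t₁ + ρ ∧ ‖stoppedValue G τ γ - paraObsCap (V γ) w u‖ ≤ ρ) := by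
  obtain ⟨𝒢, σ, τ, hσ, M, G, hτ, hmart, hστ, hτM, hVm, hGval, hdich⟩ :=
    stub_paraExplorationData D δ a a' b z φ V (w.im ^ 2 / 16) θ S₀ s₁ t₁ hθ hS₀ hS hst hT hcyl
      hstem hcons
  refine ⟨𝒢, G, σ, τ, hσ, M, hτ, hmart, hστ, hτM, hVm, fun m γ ↦ ?_, fun γ hγ ↦ ?_⟩
  · obtain ⟨k, hk, hkT⟩ := hGval m γ
    rw [hk]; exact hbound γ k hkT
  simp only [mem_union, not_or] at hγ
  obtain ⟨⟨⟨hO, hF⟩, hnr⟩, hfa⟩ := hγ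
  obtain ⟨j, k, hσj, hτk, hsj, hjs, htk, hkt, hlast⟩ := hdich γ hO
  simp only [mem_setOf_eq, not_exists, not_and, not_lt] at hF hfa
  have hS₀s : (S₀ : ℝ) ≤ s₁ := NNReal.coe_le_coe.2 hS
  -- the capacity times of the two first passages, and the approximations there
  have key : ∀ (L : ℝ≥0) (i : ℕ), (L : ℝ) ≤ LatticeSlit.capTime φ (prefixAt γ i) →
      LatticeSlit.capTime φ (prefixAt γ i) ≤ L + θ → (S₀ : ℝ) ≤ L → (L : ℝ) + θ ≤ w.im ^ 2 / 16 →
      ∃ u : ℝ≥0, L ≤ u ∧ (u : ℝ) ≤ L + ρ ∧ (u : ℝ) = LatticeSlit.capTime φ (prefixAt γ i) ∧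
        u ≤ capTimeOf w ∧
        ‖paraDoob D δ a a' b z γ i - paraObsCap (V γ) w u‖ ≤ εO + ρF := by
    intro L i hLi hiL hSL hLT
    have hpos : 0 ≤ LatticeSlit.capTime φ (prefixAt γ i) := le_trans L.coe_nonneg hLi
    have hiT : LatticeSlit.capTime φ (prefixAt γ i) ≤ w.im ^ 2 / 16 := by linarith
    set u : ℝ≥0 := (LatticeSlit.capTime φ (prefixAt γ i)).toNNReal with hu
    have huc : (u : ℝ) = LatticeSlit.capTime φ (prefixAt γ i) := Real.coe_toNNReal _ hpos
    refine ⟨u, ?_, ?_, huc, ?_, ?_⟩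
    · rw [← NNReal.coe_le_coe, huc]; exact hLi
    · rw [huc]; linarith
    · rw [← NNReal.coe_le_coe, huc, coe_capTimeOf]; exact hiT
    have h1 := happx γ hnr i hiT
    have h2 := hF i (hSL.trans hLi) hiT
    calc ‖paraDoob D δ a a' b z γ i - paraObsCap (V γ) w u‖
        ≤ ‖paraDoob D δ a a' b z γ i - hullParaObs (LatticeSlit.pastHull φ (prefixAt γ i))
              (LatticeSlit.drivingValue φ (prefixAt γ i)) w‖ +
            ‖paraObsCap (V γ) w u - hullParaObs (LatticeSlit.pastHull φ (prefixAt γ i))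
              (LatticeSlit.drivingValue φ (prefixAt γ i)) w‖ := norm_sub_le_norm_sub_add_norm_sub' _ _ _
      _ ≤ εO + ρF := add_le_add h1 h2
  obtain ⟨uσ, h1σ, h2σ, h3σ, -, h4σ⟩ := key s₁ j hsj hjs hS₀s (by
    have := NNReal.coe_le_coe.2 hst; linarith)
  obtain ⟨uτ, h1τ, h2τ, h3τ, h5τ, h4τ⟩ := key t₁ k htk hkt (hS₀s.trans (NNReal.coe_le_coe.2 hst))
    (by linarith)
  rcases hlast with ⟨hGσ, hGτ⟩ | hQk
  · rw [hGσ, hGτ]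
    exact ⟨⟨uσ, h1σ, h2σ, h4σ.trans hερ⟩, ⟨uτ, h1τ, h2τ, h4τ.trans hερ⟩⟩
  · -- the vanishing branch is excluded off the far-driver event
    exfalso
    refine hfa uτ ⟨bot_le, h5τ⟩ ?_
    by_contra hge
    have hΞ : |V γ uτ| ≤ Ξ := (not_le.1 hge).le
    have hST : Loewner.ShortTime (V γ) w uτ := by
      refine ⟨(V γ).continuous, hw, ?_⟩
      have := NNReal.coe_le_coe.2 h5τ
      rw [coe_capTimeOf] at this
      nlinarith [sq_nonneg w.im]
    have hlow := exp_le_norm_paraObs_of_abs_le hST hΞ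
    have hcap : paraObsCap (V γ) w uτ = paraObs (V γ) w uτ := paraObsCap_eq h5τ
    rw [hQk, zero_sub, norm_neg, hcap] at h4τ
    linarith

/-! ## The frozen extension from a fixed starting time -/

/-- **The frozen extension of a complex cylinder identity from a fixed starting time** (variant of the
landed `integral_sub_mul_eq_zero_of_forall_lt_of_frozen_complex`): for a complex process `X` with
continuous paths, a.e. strongly measurable, bounded, frozen after `T`, and a real test function `Ψ`,
a.e. strongly measurable with `|Ψ| ≤ 1` (finite measure), if `∫ (X_{t'} - X_{s₁}) Ψ = 0` for all
`s ≤ s₁` with `0 < s₁ < t' < T`, then `∫ (X_t - X_s) Ψ = 0` for every `t ≥ s`.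
[cite: CDHKSCRAS2014, §3] -/
theorem integral_sub_mul_eq_zero_of_frozen_of_forall_le_lt {Ω : Type*} {mΩ : MeasurableSpace Ω}
    {μ : Measure Ω} [IsFiniteMeasure μ] {X : ℝ≥0 → Ω → ℂ} {T : ℝ≥0}
    (hfrozen : ∀ u, T ≤ u → ∀ ω, X u ω = X T ω) (hcont : ∀ ω, Continuous fun u ↦ X u ω)
    (hmeas : ∀ u, AEStronglyMeasurable (X u) μ) {C : ℝ} (hbd : ∀ u ω, ‖X u ω‖ ≤ C)
    {Ψ : Ω → ℝ} (hΨm : AEStronglyMeasurable Ψ μ) (hΨ1 : ∀ ω, |Ψ ω| ≤ 1) {s : ℝ≥0}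
    (h : ∀ s₁ t' : ℝ≥0, s ≤ s₁ → 0 < s₁ → s₁ < t' → t' < T →
      ∫ ω, (X t' ω - X s₁ ω) * (Ψ ω : ℂ) ∂μ = 0)
    {t : ℝ≥0} (hst : s ≤ t) : ∫ ω, (X t ω - X s ω) * (Ψ ω : ℂ) ∂μ = 0 := by
  -- adapted from `integral_sub_mul_eq_zero_of_forall_lt_of_frozen_complex` (…ParaPassageAssemblyData)
  have hint : ∀ s t : ℝ≥0, Integrable (fun ω ↦ (X t ω - X s ω) * (Ψ ω : ℂ)) μ := by
    intro s t
    refine Integrable.mul_bdd ?_ (Complex.continuous_ofReal.comp_aestronglyMeasurable hΨm)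
      (c := 1) (ae_of_all _ fun ω ↦ by rw [Complex.norm_real, Real.norm_eq_abs]; exact hΨ1 ω)
    exact Integrable.of_bound ((hmeas t).sub (hmeas s)) (C + C)
      (ae_of_all _ fun ω ↦ (norm_sub_le _ _).trans (add_le_add (hbd t ω) (hbd s ω)))
  have hL : ∀ (L : ℂ →L[ℝ] ℝ) (s t : ℝ≥0),
      L (∫ ω, (X t ω - X s ω) * (Ψ ω : ℂ) ∂μ) = ∫ ω, (L (X t ω) - L (X s ω)) * Ψ ω ∂μ := by
    intro L s t
    rw [← L.integral_comp_comm (hint s t)]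
    refine integral_congr_ae (ae_of_all _ fun ω ↦ ?_)
    show L ((X t ω - X s ω) * (Ψ ω : ℂ)) = (L (X t ω) - L (X s ω)) * Ψ ω
    rw [mul_comm (X t ω - X s ω), ← Complex.real_smul, L.map_smul, map_sub, smul_eq_mul, mul_comm]
  have hreal : ∀ L : ℂ →L[ℝ] ℝ, ∫ ω, (L (X t ω) - L (X s ω)) * Ψ ω ∂μ = 0 := by
    intro L
    have hLb : ∀ u ω, |L (X u ω)| ≤ ‖L‖ * C := fun u ω ↦ by
      rw [← Real.norm_eq_abs]
      exact (L.le_opNorm _).trans (mul_le_mul_of_nonneg_left (hbd u ω) (norm_nonneg _))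
    have hLm : ∀ u, AEStronglyMeasurable (fun ω ↦ L (X u ω)) μ := fun u ↦
      L.continuous.comp_aestronglyMeasurable (hmeas u)
    have hLc : ∀ ω, Continuous fun u ↦ L (X u ω) := fun ω ↦ L.continuous.comp (hcont ω)
    refine Literature.Probability.Process.integral_sub_mul_eq_zero_of_forall_lt_of_frozen
      (X := fun u ω ↦ L (X u ω)) (T := T) (fun u hu ω ↦ by simp only [hfrozen u hu ω]) hLc hLm hLb
      hΨm hΨ1 (fun t' hst' ht'T ↦ ?_) hst
    rcases eq_or_ne s 0 with hs0 | hs0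
    · subst hs0
      exact Literature.Probability.Process.integral_sub_mul_eq_zero_zero_of_forall_pos
        (X := fun u ω ↦ L (X u ω)) hLc hLm hLb hΨm hΨ1 hst' fun s₁ hs₁ hs₁t ↦ by
          rw [← hL, h s₁ t' bot_le hs₁ hs₁t ht'T, map_zero]
    · rw [← hL, h s t' le_rfl (pos_iff_ne_zero.2 hs0) hst' ht'T, map_zero]
  apply Complex.ext
  · rw [show (∫ ω, (X t ω - X s ω) * (Ψ ω : ℂ) ∂μ).re = Complex.reCLM (∫ ω, (X t ω - X s ω) *
      (Ψ ω : ℂ) ∂μ) from rfl, hL, hreal, Complex.zero_re]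
  · rw [show (∫ ω, (X t ω - X s ω) * (Ψ ω : ℂ) ∂μ).im = Complex.imCLM (∫ ω, (X t ω - X s ω) *
      (Ψ ω : ℂ) ∂μ) from rfl, hL, hreal, Complex.zero_im]

end Summit.CriticalPhenomena.SAWScalingLimit.Theorems.SubseqIdentification.ParaMartingale

end
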